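import Mathlib
import Summits.Ventures.PercRepro2.Defs
import Summits.Ventures.PercRepro2.Independence
import Summits.Ventures.PercRepro2.Harris
import Summits.Ventures.PercRepro2.Graph
import Summits.Ventures.PercRepro2.Events
import Summits.Ventures.PercRepro2.PsiUniSure
import Summits.Ventures.PercRepro2.PsiUniExplored
import Summits.Ventures.PercRepro2.PsiTEdge
import Summits.Ventures.PercRepro2.R21OEdgeSGraph

/-!
# The unmarked far end of the `o`-exploration when `z` cannot reach `s` off `Λ_o` (PercRepro2, p2)

For an unpinned edge `f = {x, z}` with `x` in the explored `o`-component, opening `f` merges the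
clusters of `o` and `z`; in closed-world terms (`Z_v = {z ↔ v}`, `O_u = {o ↔ u}`):
`h¹ = h ∨ Z_s`, `ℓ¹ = ℓ ∨ Z_y`, `a¹ = a ∨ (h ∧ Z_u) ∨ (Z_s ∧ O_u)`, `𝟙¹ = 𝟙 ∧ ¬(h ∧ Z_y) ∧ ¬(Z_s ∧ ℓ)`
(`r21_generic_transfer`, the nine open-world masses as closed-world masses).  When every `z`–`s`
path of the support passes through `Λ_o` — the closed-world event `{z ↔ s} ∩ {z ↮ o}` is NULL —
the `Z_s`-terms drop out (`Z_s ⟹ h`) and the one-edge defect of the (R2-1) slack is a single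
product of probabilities (P2-G21-SINGLEEDGE.md §2.1):

  **`T_f − R(p[f↦0]) − R(p[f↦1]) = P⁰(𝟙, o ∉ C_s ∪ C_y, z ∈ C_y) · P⁰(o ∈ C_s, u ∈ C_z, u ∉ C_s) ≥ 0`**

(`r21_delta_eq_of_no_s_path`, `r21_uni_o_edge_generic_of_no_s_path`): the `s`-connection of the far
end off `Λ_o` is the only obstruction to the δ-form at an unmarked far end (the LP of the record:
with the cells `{z ↔ s, z ↮ o}` removed the δ-forms are certified by products alone; with the
`y`-cells removed instead they are not).  Exact check: 30 / 30 instances (delta_formula_test.py).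

* `prob_eq_expect_of_null` — probabilities through indicators agreeing off a null set;
* `r21_generic_transfer` — the nine open-world masses in closed-world terms;
* `r21_generic_masses_of_no_s_path` — the nine open-world masses as affine forms in the closed
  masses and six extra atoms, under the null hypothesis;
* `r21_delta_eq_of_no_s_path`, `r21_uni_o_edge_generic_of_no_s_path` — **the theorems**.
-/

namespace Summit.Ventures.PercRepro2

section GenericNoS

variable {V : Type*} {E : Type*} [Fintype E] [DecidableEq E]
  {R : Type*} [CommRing R] [LinearOrder R] [IsStrictOrderedRing R]

/-- The weight vanishes on every configuration of a null event. -/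
lemma weight_eq_zero_of_mem_null {p : E → R} (hp : IsProbVec p) {N : Set (Config E)}
    (hN : prob p N = 0) {ω : Config E} (hω : ω ∈ N) : weight p ω = 0 := by
  classical
  unfold prob at hN
  have hterm : ∀ ω' ∈ (Finset.univ : Finset (Config E)), 0 ≤ N.indicator (weight p) ω' :=
    fun ω' _ => Set.indicator_nonneg (fun ω'' _ => weight_nonneg hp ω'') ω'
  have := (Finset.sum_eq_zero_iff_of_nonneg hterm).1 hN ω (Finset.mem_univ _)
  rwa [Set.indicator_of_mem hω] at this

/-- **Probabilities through indicators off a null set**: if the indicator of `A` agrees with `g`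
outside a null event `N`, then `P(A) = E[g]`. -/
lemma prob_eq_expect_of_null {p : E → R} (hp : IsProbVec p) {N : Set (Config E)}
    (hN : prob p N = 0) {A : Set (Config E)} {g : Config E → R}
    (h : ∀ ω, ω ∉ N → A.indicator 1 ω = g ω) : prob p A = expect p g := by
  classical
  rw [prob_eq_expect_indicator]
  unfold expect
  refine Finset.sum_congr rfl fun ω _ => ?_
  by_cases hω : ω ∈ N
  · rw [weight_eq_zero_of_mem_null hp hN hω, zero_mul, zero_mul]
  · rw [h ω hω]


/-- **Linear identities of probabilities off a null set**: if `1_A = 1_B + c₁·1_C + c₂·1_D` outside a null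
event, then `P(A) = P(B) + c₁·P(C) + c₂·P(D)`. -/
lemma prob_eq_lin_of_null {p : E → R} (hp : IsProbVec p) {N : Set (Config E)} (hN : prob p N = 0)
    {A B C D : Set (Config E)} (c₁ c₂ : R)
    (h : ∀ ω, ω ∉ N → A.indicator (1 : Config E → R) ω =
      B.indicator 1 ω + c₁ * C.indicator 1 ω + c₂ * D.indicator 1 ω) :
    prob p A = prob p B + c₁ * prob p C + c₂ * prob p D := by
  rw [prob_eq_expect_of_null hp hN (g := B.indicator 1 + (fun ω => c₁ * C.indicator 1 ω) +
      (fun ω => c₂ * D.indicator 1 ω)) (fun ω hω => by simp only [Pi.add_apply]; exact h ω hω),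
    expect_add, expect_add, expect_const_mul, expect_const_mul, ← prob_eq_expect_indicator,
    ← prob_eq_expect_indicator, ← prob_eq_expect_indicator]


set_option linter.unusedSimpArgs false in
omit [IsStrictOrderedRing R] in
/-- **The open world of a generic far end, in closed-world terms**: opening `f = {x, z}` merges the
clusters of `o` (≡ `x`) and `z`. -/
lemma r21_generic_transfer (p : E → R) (ends : E → Sym2 V) (s y o u x z : V) (f : E)
    (hf : ends f = s(x, z)) (hx : Conn ends (fun e => decide (p e = 1)) o x) (hpf : p f ≠ 1) :
      prob (Function.update p f 1) (connEvent ends s u ∩ clusterInEvent ends s {W : Set V | o ∈ W} ∩ (connEvent ends s y)ᶜ) =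
        prob (Function.update p f 0) {ω : Config E | (Conn ends ω s u ∨ (Conn ends ω s o ∧ Conn ends ω z u) ∨ (Conn ends ω z s ∧ Conn ends ω o u)) ∧ (Conn ends ω s o ∨ (Conn ends ω s o ∧ Conn ends ω z o) ∨ Conn ends ω z s) ∧ ¬(Conn ends ω s y ∨ (Conn ends ω s o ∧ Conn ends ω z y) ∨ (Conn ends ω z s ∧ Conn ends ω y o))} ∧
      prob (Function.update p f 1) (connEvent ends s u ∩ connEvent ends y o ∩ (connEvent ends s y)ᶜ) =
        prob (Function.update p f 0) {ω : Config E | (Conn ends ω s u ∨ (Conn ends ω s o ∧ Conn ends ω z u) ∨ (Conn ends ω z s ∧ Conn ends ω o u)) ∧ (Conn ends ω y o ∨ (Conn ends ω y o ∧ Conn ends ω z o) ∨ Conn ends ω z y) ∧ ¬(Conn ends ω s y ∨ (Conn ends ω s o ∧ Conn ends ω z y) ∨ (Conn ends ω z s ∧ Conn ends ω y o))} ∧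
      prob (Function.update p f 1) ((connEvent ends s y)ᶜ) =
        prob (Function.update p f 0) {ω : Config E | ¬(Conn ends ω s y ∨ (Conn ends ω s o ∧ Conn ends ω z y) ∨ (Conn ends ω z s ∧ Conn ends ω y o))} ∧
      prob (Function.update p f 1) (connEvent ends s u ∩ clusterInEvent ends s {W : Set V | o ∈ W}) =
        prob (Function.update p f 0) {ω : Config E | (Conn ends ω s u ∨ (Conn ends ω s o ∧ Conn ends ω z u) ∨ (Conn ends ω z s ∧ Conn ends ω o u)) ∧ (Conn ends ω s o ∨ (Conn ends ω s o ∧ Conn ends ω z o) ∨ Conn ends ω z s)} ∧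
      prob (Function.update p f 1) (connEvent ends s u ∩ (connEvent ends s y)ᶜ) =
        prob (Function.update p f 0) {ω : Config E | (Conn ends ω s u ∨ (Conn ends ω s o ∧ Conn ends ω z u) ∨ (Conn ends ω z s ∧ Conn ends ω o u)) ∧ ¬(Conn ends ω s y ∨ (Conn ends ω s o ∧ Conn ends ω z y) ∨ (Conn ends ω z s ∧ Conn ends ω y o))} ∧
      prob (Function.update p f 1) (clusterInEvent ends s {W : Set V | o ∈ W}) =
        prob (Function.update p f 0) {ω : Config E | (Conn ends ω s o ∨ (Conn ends ω s o ∧ Conn ends ω z o) ∨ Conn ends ω z s)} ∧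
      prob (Function.update p f 1) (clusterInEvent ends s {W : Set V | o ∈ W} ∩ (connEvent ends s y)ᶜ) =
        prob (Function.update p f 0) {ω : Config E | (Conn ends ω s o ∨ (Conn ends ω s o ∧ Conn ends ω z o) ∨ Conn ends ω z s) ∧ ¬(Conn ends ω s y ∨ (Conn ends ω s o ∧ Conn ends ω z y) ∨ (Conn ends ω z s ∧ Conn ends ω y o))} ∧
      prob (Function.update p f 1) (connEvent ends s u) =
        prob (Function.update p f 0) {ω : Config E | (Conn ends ω s u ∨ (Conn ends ω s o ∧ Conn ends ω z u) ∨ (Conn ends ω z s ∧ Conn ends ω o u))} ∧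
      prob (Function.update p f 1) (connEvent ends y o ∩ (connEvent ends s y)ᶜ) =
        prob (Function.update p f 0) {ω : Config E | (Conn ends ω y o ∨ (Conn ends ω y o ∧ Conn ends ω z o) ∨ Conn ends ω z y) ∧ ¬(Conn ends ω s y ∨ (Conn ends ω s o ∧ Conn ends ω z y) ∨ (Conn ends ω z s ∧ Conn ends ω y o))} := by
  have atoms : ∀ ω : Config E, (∀ e, e ≠ f → p e = 1 → ω e = true) →
      ((Conn ends (Function.update ω f false) s x ↔ Conn ends (Function.update ω f false) s o) ∧
       (Conn ends (Function.update ω f false) x o ↔ True) ∧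
       (Conn ends (Function.update ω f false) x u ↔ Conn ends (Function.update ω f false) o u) ∧
       (Conn ends (Function.update ω f false) y x ↔ Conn ends (Function.update ω f false) y o) ∧
       (Conn ends (Function.update ω f false) x y ↔ Conn ends (Function.update ω f false) y o) ∧
       (Conn ends (Function.update ω f false) z o ↔ Conn ends (Function.update ω f false) z o) ∧
       (Conn ends (Function.update ω f false) s z ↔ Conn ends (Function.update ω f false) z s) ∧
       (Conn ends (Function.update ω f false) y z ↔ Conn ends (Function.update ω f false) z y) ∧
       (Conn ends (Function.update ω f false) o s ↔ Conn ends (Function.update ω f false) s o)) := by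
    intro ω h1
    have hxv := conn_x_iff_o (ends := ends) hx hpf h1
    refine ⟨?_, ?_, ?_, ?_, ?_, Iff.rfl, ?_, ?_, ?_⟩
    · exact ⟨fun h => conn_symm ((hxv s).1 (conn_symm h)), fun h => conn_symm ((hxv s).2 (conn_symm h))⟩
    · exact ⟨fun _ => trivial, fun _ => (hxv o).2 (conn_refl _ _ _)⟩
    · exact hxv u
    · exact ⟨fun h => conn_symm ((hxv y).1 (conn_symm h)), fun h => conn_symm ((hxv y).2 (conn_symm h))⟩
    · exact ⟨fun h => conn_symm ((hxv y).1 h), fun h => (hxv y).2 (conn_symm h)⟩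
    · exact ⟨fun h => conn_symm h, fun h => conn_symm h⟩
    · exact ⟨fun h => conn_symm h, fun h => conn_symm h⟩
    · exact ⟨fun h => conn_symm h, fun h => conn_symm h⟩
  refine ⟨?_, ?_, ?_, ?_, ?_, ?_, ?_, ?_, ?_⟩ <;>
  · refine prob_update_one_eq_prob_update_zero_of_respects p f fun ω _ h1 => ?_
    obtain ⟨hsx, hxo, hxu, hyx, hxy, _, hsz, hyz, hos⟩ := atoms ω h1
    simp only [Set.mem_inter_iff, mem_connEvent, mem_clusterInEvent, Set.mem_setOf_eq, mem_cluster,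
      Set.mem_compl_iff, conn_update_true_iff_or hf, hsx, hxo, hxu, hyx, hxy, hsz, hyz, hos,
      and_true, and_assoc]

set_option linter.unusedSimpArgs false in
/-- **The open-world masses under the null hypothesis** `P⁰(z ↔ s, z ↮ o) = 0`: affine forms in the closed
masses and the six atoms `η = P(𝟙 a h Z_y)`, `γ = P(𝟙 aᶜ h Z_u Z_yᶜ)`, `ε = P(𝟙 a hᶜ ℓᶜ Z_y)`, `α = P(𝟙 h Z_y)`,
`β = P(aᶜ h Z_u)`, `δ′ = P(𝟙 hᶜ ℓᶜ Z_y)`. -/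
lemma r21_generic_masses_of_no_s_path (p : E → R) (hp : IsProbVec p) (ends : E → Sym2 V) (s y o u z : V) (f : E)
    (hN : prob (Function.update p f 0) (connEvent ends z s ∩ (connEvent ends z o)ᶜ) = 0) :
      prob (Function.update p f 0) {ω : Config E | (Conn ends ω s u ∨ (Conn ends ω s o ∧ Conn ends ω z u) ∨ (Conn ends ω z s ∧ Conn ends ω o u)) ∧ (Conn ends ω s o ∨ (Conn ends ω s o ∧ Conn ends ω z o) ∨ Conn ends ω z s) ∧ ¬(Conn ends ω s y ∨ (Conn ends ω s o ∧ Conn ends ω z y) ∨ (Conn ends ω z s ∧ Conn ends ω y o))} =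
        prob (Function.update p f 0) (connEvent ends s u ∩ clusterInEvent ends s {W : Set V | o ∈ W} ∩ (connEvent ends s y)ᶜ) + (-1) * prob (Function.update p f 0) {ω : Config E | ¬Conn ends ω s y ∧ Conn ends ω s u ∧ Conn ends ω s o ∧ Conn ends ω z y} + 1 * prob (Function.update p f 0) {ω : Config E | ¬Conn ends ω s y ∧ ¬Conn ends ω s u ∧ Conn ends ω s o ∧ Conn ends ω z u ∧ ¬Conn ends ω z y} ∧
      prob (Function.update p f 0) {ω : Config E | (Conn ends ω s u ∨ (Conn ends ω s o ∧ Conn ends ω z u) ∨ (Conn ends ω z s ∧ Conn ends ω o u)) ∧ (Conn ends ω y o ∨ (Conn ends ω y o ∧ Conn ends ω z o) ∨ Conn ends ω z y) ∧ ¬(Conn ends ω s y ∨ (Conn ends ω s o ∧ Conn ends ω z y) ∨ (Conn ends ω z s ∧ Conn ends ω y o))} =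
        prob (Function.update p f 0) (connEvent ends s u ∩ connEvent ends y o ∩ (connEvent ends s y)ᶜ) + 1 * prob (Function.update p f 0) {ω : Config E | ¬Conn ends ω s y ∧ Conn ends ω s u ∧ ¬Conn ends ω s o ∧ ¬Conn ends ω y o ∧ Conn ends ω z y} + 0 * prob (Function.update p f 0) {ω : Config E | ¬Conn ends ω s y ∧ Conn ends ω s u ∧ ¬Conn ends ω s o ∧ ¬Conn ends ω y o ∧ Conn ends ω z y} ∧
      prob (Function.update p f 0) {ω : Config E | ¬(Conn ends ω s y ∨ (Conn ends ω s o ∧ Conn ends ω z y) ∨ (Conn ends ω z s ∧ Conn ends ω y o))} =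
        prob (Function.update p f 0) ((connEvent ends s y)ᶜ) + (-1) * prob (Function.update p f 0) {ω : Config E | ¬Conn ends ω s y ∧ Conn ends ω s o ∧ Conn ends ω z y} + 0 * prob (Function.update p f 0) {ω : Config E | ¬Conn ends ω s y ∧ Conn ends ω s o ∧ Conn ends ω z y} ∧
      prob (Function.update p f 0) {ω : Config E | (Conn ends ω s u ∨ (Conn ends ω s o ∧ Conn ends ω z u) ∨ (Conn ends ω z s ∧ Conn ends ω o u)) ∧ (Conn ends ω s o ∨ (Conn ends ω s o ∧ Conn ends ω z o) ∨ Conn ends ω z s)} =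
        prob (Function.update p f 0) (connEvent ends s u ∩ clusterInEvent ends s {W : Set V | o ∈ W}) + 1 * prob (Function.update p f 0) {ω : Config E | ¬Conn ends ω s u ∧ Conn ends ω s o ∧ Conn ends ω z u} + 0 * prob (Function.update p f 0) {ω : Config E | ¬Conn ends ω s u ∧ Conn ends ω s o ∧ Conn ends ω z u} ∧
      prob (Function.update p f 0) {ω : Config E | (Conn ends ω s u ∨ (Conn ends ω s o ∧ Conn ends ω z u) ∨ (Conn ends ω z s ∧ Conn ends ω o u)) ∧ ¬(Conn ends ω s y ∨ (Conn ends ω s o ∧ Conn ends ω z y) ∨ (Conn ends ω z s ∧ Conn ends ω y o))} =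
        prob (Function.update p f 0) (connEvent ends s u ∩ (connEvent ends s y)ᶜ) + (-1) * prob (Function.update p f 0) {ω : Config E | ¬Conn ends ω s y ∧ Conn ends ω s u ∧ Conn ends ω s o ∧ Conn ends ω z y} + 1 * prob (Function.update p f 0) {ω : Config E | ¬Conn ends ω s y ∧ ¬Conn ends ω s u ∧ Conn ends ω s o ∧ Conn ends ω z u ∧ ¬Conn ends ω z y} ∧
      prob (Function.update p f 0) {ω : Config E | (Conn ends ω s o ∨ (Conn ends ω s o ∧ Conn ends ω z o) ∨ Conn ends ω z s)} =
        prob (Function.update p f 0) (clusterInEvent ends s {W : Set V | o ∈ W}) + 0 * prob (Function.update p f 0) {ω : Config E | ¬Conn ends ω s u ∧ Conn ends ω s o ∧ Conn ends ω z u} + 0 * prob (Function.update p f 0) {ω : Config E | ¬Conn ends ω s u ∧ Conn ends ω s o ∧ Conn ends ω z u} ∧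
      prob (Function.update p f 0) {ω : Config E | (Conn ends ω s o ∨ (Conn ends ω s o ∧ Conn ends ω z o) ∨ Conn ends ω z s) ∧ ¬(Conn ends ω s y ∨ (Conn ends ω s o ∧ Conn ends ω z y) ∨ (Conn ends ω z s ∧ Conn ends ω y o))} =
        prob (Function.update p f 0) (clusterInEvent ends s {W : Set V | o ∈ W} ∩ (connEvent ends s y)ᶜ) + (-1) * prob (Function.update p f 0) {ω : Config E | ¬Conn ends ω s y ∧ Conn ends ω s o ∧ Conn ends ω z y} + 0 * prob (Function.update p f 0) {ω : Config E | ¬Conn ends ω s y ∧ Conn ends ω s o ∧ Conn ends ω z y} ∧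
      prob (Function.update p f 0) {ω : Config E | (Conn ends ω s u ∨ (Conn ends ω s o ∧ Conn ends ω z u) ∨ (Conn ends ω z s ∧ Conn ends ω o u))} =
        prob (Function.update p f 0) (connEvent ends s u) + 1 * prob (Function.update p f 0) {ω : Config E | ¬Conn ends ω s u ∧ Conn ends ω s o ∧ Conn ends ω z u} + 0 * prob (Function.update p f 0) {ω : Config E | ¬Conn ends ω s u ∧ Conn ends ω s o ∧ Conn ends ω z u} ∧
      prob (Function.update p f 0) {ω : Config E | (Conn ends ω y o ∨ (Conn ends ω y o ∧ Conn ends ω z o) ∨ Conn ends ω z y) ∧ ¬(Conn ends ω s y ∨ (Conn ends ω s o ∧ Conn ends ω z y) ∨ (Conn ends ω z s ∧ Conn ends ω y o))} =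
        prob (Function.update p f 0) (connEvent ends y o ∩ (connEvent ends s y)ᶜ) + 1 * prob (Function.update p f 0) {ω : Config E | ¬Conn ends ω s y ∧ ¬Conn ends ω s o ∧ ¬Conn ends ω y o ∧ Conn ends ω z y} + 0 * prob (Function.update p f 0) {ω : Config E | ¬Conn ends ω s y ∧ ¬Conn ends ω s o ∧ ¬Conn ends ω y o ∧ Conn ends ω z y} := by
  classical
  have hq : IsProbVec (Function.update p f 0) := hp.update f le_rfl zero_le_one
  refine ⟨?_, ?_, ?_, ?_, ?_, ?_, ?_, ?_, ?_⟩ <;>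
  · refine prob_eq_lin_of_null hq hN _ _ fun ω hω => ?_
    have F1 : Conn ends ω z s → Conn ends ω z o := fun hzs => by
      by_contra hzo; exact hω ⟨hzs, hzo⟩
    have F2 : Conn ends ω z s → Conn ends ω z o → Conn ends ω s o :=
      fun h1 h2 => conn_trans (conn_symm h1) h2
    have F3 : Conn ends ω s o → Conn ends ω y o → Conn ends ω s y :=
      fun h1 h2 => conn_trans h1 (conn_symm h2)
    have F4 : Conn ends ω s o → Conn ends ω o u → Conn ends ω s u := fun h1 h2 => conn_trans h1 h2
    have ha1 : (Conn ends ω s u ∨ (Conn ends ω s o ∧ Conn ends ω z u) ∨ (Conn ends ω z s ∧ Conn ends ω o u)) ↔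
        (Conn ends ω s u ∨ (Conn ends ω s o ∧ Conn ends ω z u)) := by
      constructor
      · rintro (h | h | ⟨h1, h2⟩)
        · exact Or.inl h
        · exact Or.inr h
        · exact Or.inl (F4 (F2 h1 (F1 h1)) h2)
      · rintro (h | h)
        · exact Or.inl h
        · exact Or.inr (Or.inl h)
    have hh1 : (Conn ends ω s o ∨ (Conn ends ω s o ∧ Conn ends ω z o) ∨ Conn ends ω z s) ↔ Conn ends ω s o := by
      constructor
      · rintro (h | ⟨h, _⟩ | h)
        · exact h
        · exact h
        · exact F2 h (F1 h)
      · exact fun h => Or.inl h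
    have hl1 : (Conn ends ω y o ∨ (Conn ends ω y o ∧ Conn ends ω z o) ∨ Conn ends ω z y) ↔
        (Conn ends ω y o ∨ Conn ends ω z y) := by
      constructor
      · rintro (h | ⟨h, _⟩ | h)
        · exact Or.inl h
        · exact Or.inl h
        · exact Or.inr h
      · rintro (h | h)
        · exact Or.inl h
        · exact Or.inr (Or.inr h)
    have hQ1 : (¬(Conn ends ω s y ∨ (Conn ends ω s o ∧ Conn ends ω z y) ∨ (Conn ends ω z s ∧ Conn ends ω y o))) ↔
        (¬Conn ends ω s y ∧ ¬(Conn ends ω s o ∧ Conn ends ω z y)) := by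
      constructor
      · intro h
        exact ⟨fun h' => h (Or.inl h'), fun h' => h (Or.inr (Or.inl h'))⟩
      · rintro ⟨h1, h2⟩ (h | h | ⟨h3, h4⟩)
        · exact h1 h
        · exact h2 h
        · exact h1 (F3 (F2 h3 (F1 h3)) h4)
    simp only [Set.indicator_apply, Set.mem_setOf_eq, Set.mem_inter_iff, Set.mem_compl_iff,
      mem_connEvent, mem_clusterInEvent, mem_cluster, Pi.one_apply, ha1, hh1, hl1, hQ1]
    clear ha1 hh1 hl1 hQ1 F1 F2 F4 hω
    by_cases hsu : Conn ends ω s u <;> by_cases hso : Conn ends ω s o <;>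
      by_cases hyo : Conn ends ω y o <;> by_cases hsy : Conn ends ω s y <;>
      by_cases hzy : Conn ends ω z y <;> by_cases hzu : Conn ends ω z u <;>
      simp_all

/-- **The δ-form at an unmarked far end whose `s`-paths all pass through `Λ_o`**: the one-edge defect is the
product `P⁰(𝟙, o ∉ C_s ∪ C_y, z ∈ C_y) · P⁰(o ∈ C_s, u ∈ C_z, u ∉ C_s)`. -/
theorem r21_delta_eq_of_no_s_path (p : E → R) (hp : IsProbVec p) (ends : E → Sym2 V) (s y o u x z : V) (f : E)
    (hf : ends f = s(x, z)) (hx : Conn ends (fun e => decide (p e = 1)) o x) (hpf : p f ≠ 1)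
    (hN : prob (Function.update p f 0) (connEvent ends z s ∩ (connEvent ends z o)ᶜ) = 0) :
    (prob (Function.update p f 0) (connEvent ends s u ∩ clusterInEvent ends s {W : Set V | o ∈ W} ∩ (connEvent ends s y)ᶜ) + prob (Function.update p f 1) (connEvent ends s u ∩ clusterInEvent ends s {W : Set V | o ∈ W} ∩ (connEvent ends s y)ᶜ) + prob (Function.update p f 0) (connEvent ends s u ∩ connEvent ends y o ∩ (connEvent ends s y)ᶜ) + prob (Function.update p f 1) (connEvent ends s u ∩ connEvent ends y o ∩ (connEvent ends s y)ᶜ) + prob (Function.update p f 0) ((connEvent ends s y)ᶜ) * prob (Function.update p f 1) (connEvent ends s u ∩ clusterInEvent ends s {W : Set V | o ∈ W}) + prob (Function.update p f 1) ((connEvent ends s y)ᶜ) * prob (Function.update p f 0) (connEvent ends s u ∩ clusterInEvent ends s {W : Set V | o ∈ W}) - (prob (Function.update p f 0) (connEvent ends s u ∩ (connEvent ends s y)ᶜ) * prob (Function.update p f 1) (clusterInEvent ends s {W : Set V | o ∈ W}) + prob (Function.update p f 1) (connEvent ends s u ∩ (connEvent ends s y)ᶜ) * prob (Function.update p f 0)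 (clusterInEvent ends s {W : Set V | o ∈ W}) + prob (Function.update p f 0) (clusterInEvent ends s {W : Set V | o ∈ W} ∩ (connEvent ends s y)ᶜ) * prob (Function.update p f 1) (connEvent ends s u) + prob (Function.update p f 1) (clusterInEvent ends s {W : Set V | o ∈ W} ∩ (connEvent ends s y)ᶜ) * prob (Function.update p f 0) (connEvent ends s u) + prob (Function.update p f 0) (connEvent ends y o ∩ (connEvent ends s y)ᶜ) * prob (Function.update p f 1) (connEvent ends s u) + prob (Function.update p f 1) (connEvent ends y o ∩ (connEvent ends s y)ᶜ) * prob (Function.update p f 0) (connEvent ends s u))) - (prob (Function.update p f 0) (connEvent ends s u ∩ clusterInEvent ends s {W : Set V | o ∈ W} ∩ (connEvent ends s y)ᶜ) + prob (Function.update p f 0) (connEvent ends s u ∩ connEvent ends y o ∩ (connEvent ends s y)ᶜ) + prob (Function.update p f 0) ((connEvent ends s y)ᶜ) * prob (Function.update p f 0) (connEvent ends s u ∩ clusterInEvent ends s {W : Set V | o ∈ W}) - (prob (Function.update p f 0) (connEvent ends s u ∩ (connEvent ends s y)ᶜ) * prob (Function.update p f 0) (clusterInEvent ends s {W : Set V |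 o ∈ W}) + prob (Function.update p f 0) (clusterInEvent ends s {W : Set V | o ∈ W} ∩ (connEvent ends s y)ᶜ) * prob (Function.update p f 0) (connEvent ends s u) + prob (Function.update p f 0) (connEvent ends y o ∩ (connEvent ends s y)ᶜ) * prob (Function.update p f 0) (connEvent ends s u))) - (prob (Function.update p f 1) (connEvent ends s u ∩ clusterInEvent ends s {W : Set V | o ∈ W} ∩ (connEvent ends s y)ᶜ) + prob (Function.update p f 1) (connEvent ends s u ∩ connEvent ends y o ∩ (connEvent ends s y)ᶜ) + prob (Function.update p f 1) ((connEvent ends s y)ᶜ) * prob (Function.update p f 1) (connEvent ends s u ∩ clusterInEvent ends s {W : Set V | o ∈ W}) - (prob (Function.update p f 1) (connEvent ends s u ∩ (connEvent ends s y)ᶜ) * prob (Function.update p f 1) (clusterInEvent ends s {W : Set V | o ∈ W}) + prob (Function.update p f 1) (clusterInEvent ends s {W : Set V | o ∈ W} ∩ (connEvent ends s y)ᶜ) * prob (Function.update p f 1) (connEvent ends s u) + prob (Function.update p f 1) (connEvent ends y o ∩ (connEvent ends s y)ᶜ) * prob (Function.update p f 1) (connEvent ends s u))) =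
      prob (Function.update p f 0) {ω : Config E | ¬Conn ends ω s y ∧ ¬Conn ends ω s o ∧ ¬Conn ends ω y o ∧ Conn ends ω z y} * prob (Function.update p f 0) {ω : Config E | ¬Conn ends ω s u ∧ Conn ends ω s o ∧ Conn ends ω z u} := by
  obtain ⟨t1, t2, t3, t4, t5, t6, t7, t8, t9⟩ := r21_generic_transfer p ends s y o u x z f hf hx hpf
  obtain ⟨m1, m2, m3, m4, m5, m6, m7, m8, m9⟩ :=
    r21_generic_masses_of_no_s_path p hp ends s y o u z f hN
  rw [t1, t2, t3, t4, t5, t6, t7, t8, t9, m1, m2, m3, m4, m5, m6, m7, m8, m9]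
  ring

/-- **(UNI-T_o) at such a far end**: `R⁰ + R¹ ≤ T_f`, hence `T_f ≥ 0` under the pinned slacks. -/
theorem r21_uni_o_edge_generic_of_no_s_path (p : E → R) (hp : IsProbVec p) (ends : E → Sym2 V) (s y o u x z : V) (f : E)
    (hf : ends f = s(x, z)) (hx : Conn ends (fun e => decide (p e = 1)) o x) (hpf : p f ≠ 1)
    (hN : prob (Function.update p f 0) (connEvent ends z s ∩ (connEvent ends z o)ᶜ) = 0) :
    (prob (Function.update p f 0) (connEvent ends s u ∩ clusterInEvent ends s {W : Set V | o ∈ W} ∩ (connEvent ends s y)ᶜ) + prob (Function.update p f 0) (connEvent ends s u ∩ connEvent ends y o ∩ (connEvent ends s y)ᶜ) + prob (Function.update p f 0) ((connEvent ends s y)ᶜ) * prob (Function.update p f 0) (connEvent ends s u ∩ clusterInEvent ends s {W : Set V | o ∈ W}) - (prob (Function.update p f 0) (connEvent ends s u ∩ (connEvent ends s y)ᶜ) * prob (Function.update p f 0) (clusterInEvent ends s {W : Set V | o ∈ W}) + prob (Function.update p f 0) (clusterInEvent ends s {W : Set V | o ∈ W} ∩ (connEvent ends s y)ᶜ) * prob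 (Function.update p f 0) (connEvent ends s u) + prob (Function.update p f 0) (connEvent ends y o ∩ (connEvent ends s y)ᶜ) * prob (Function.update p f 0) (connEvent ends s u))) + (prob (Function.update p f 1) (connEvent ends s u ∩ clusterInEvent ends s {W : Set V | o ∈ W} ∩ (connEvent ends s y)ᶜ) + prob (Function.update p f 1) (connEvent ends s u ∩ connEvent ends y o ∩ (connEvent ends s y)ᶜ) + prob (Function.update p f 1) ((connEvent ends s y)ᶜ) * prob (Function.update p f 1) (connEvent ends s u ∩ clusterInEvent ends s {W : Set V | o ∈ W}) - (prob (Function.update p f 1) (connEvent ends s u ∩ (connEvent ends s y)ᶜ) * prob (Function.update p f 1) (clusterInEvent ends s {W : Set V | o ∈ W}) + prob (Function.update p f 1) (clusterInEvent ends s {W : Set V | o ∈ W} ∩ (connEvent ends s y)ᶜ) * prob (Function.update p f 1) (connEvent ends s u) + prob (Function.update p f 1) (connEvent ends y o ∩ (connEvent ends s y)ᶜ) * prob (Function.update p f 1) (connEvent ends s u))) ≤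
      (prob (Function.update p f 0) (connEvent ends s u ∩ clusterInEvent ends s {W : Set V | o ∈ W} ∩ (connEvent ends s y)ᶜ) + prob (Function.update p f 1) (connEvent ends s u ∩ clusterInEvent ends s {W : Set V | o ∈ W} ∩ (connEvent ends s y)ᶜ) + prob (Function.update p f 0) (connEvent ends s u ∩ connEvent ends y o ∩ (connEvent ends s y)ᶜ) + prob (Function.update p f 1) (connEvent ends s u ∩ connEvent ends y o ∩ (connEvent ends s y)ᶜ) + prob (Function.update p f 0) ((connEvent ends s y)ᶜ) * prob (Function.update p f 1) (connEvent ends s u ∩ clusterInEvent ends s {W : Set V | o ∈ W}) + prob (Function.update p f 1) ((connEvent ends s y)ᶜ) * prob (Function.update p f 0) (connEvent ends s u ∩ clusterInEvent ends s {W : Set V | o ∈ W}) - (prob (Function.update p f 0) (connEvent ends s u ∩ (connEvent ends s y)ᶜ) * prob (Function.update p f 1) (clusterInEvent ends s {W : Set V | o ∈ W}) + prob (Function.update p f 1) (connEvent ends s u ∩ (connEvent ends s y)ᶜ) * prob (Function.update p f 0) (clusterInEvent ends s {W : Set V | o ∈ W}) + prob (Function.update p f 0) (clusterInEvent ends s {W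 : Set V | o ∈ W} ∩ (connEvent ends s y)ᶜ) * prob (Function.update p f 1) (connEvent ends s u) + prob (Function.update p f 1) (clusterInEvent ends s {W : Set V | o ∈ W} ∩ (connEvent ends s y)ᶜ) * prob (Function.update p f 0) (connEvent ends s u) + prob (Function.update p f 0) (connEvent ends y o ∩ (connEvent ends s y)ᶜ) * prob (Function.update p f 1) (connEvent ends s u) + prob (Function.update p f 1) (connEvent ends y o ∩ (connEvent ends s y)ᶜ) * prob (Function.update p f 0) (connEvent ends s u))) := by
  have hq : IsProbVec (Function.update p f 0) := hp.update f le_rfl zero_le_one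
  have h := r21_delta_eq_of_no_s_path p hp ends s y o u x z f hf hx hpf hN
  have hnn := mul_nonneg (prob_nonneg hq {ω : Config E | ¬Conn ends ω s y ∧ ¬Conn ends ω s o ∧ ¬Conn ends ω y o ∧ Conn ends ω z y}) (prob_nonneg hq {ω : Config E | ¬Conn ends ω s u ∧ Conn ends ω s o ∧ Conn ends ω z u})
  linarith


end GenericNoS

end Summit.Ventures.PercRepro2
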